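import Summits.CriticalPhenomena.PercolationContinuityZ3.Theorems.PercNearOneGluingNoHeavyQuantBlockCombTail
import Summits.CriticalPhenomena.PercolationContinuityZ3.Theorems.PercNearOneGluingNoHeavyQuantBlockCombClass
import HarnessLib

/-!
# QUANT lane R8, FAR on trees: the CLASS corollary `(Σ a)·x > 2j` of the canonical block-comb (lead g12) in crossing form

builds on p205010 (kernel theorem, internal audit signed; external expert review pending)

Support file (`--supports stmt-CriticalPhenomena-4575`), QUANT lane typer seat prim-quant-stmt (gen 15).  Theorems only (the `local notation3` of
`…QuantBlockCombMergeModel.lean` and of `…QuantBlobWalk.lean`, verbatim), no definitions, no sorries, standard axioms.  Companion of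
`…QuantBlockCombTail.lean` (same seat: `Quant.BlockComb.tail_eq_crossing`, p1's depth decomposition = the blob-walk first-passage sum) and of lead
g12's `…QuantBlockCombClass.lean` (`Quant.BlockComb.tail_ge_of_class`: `2j < (Σ a)·x`, `x` below every live marginal ⟹ `x ≤ TAIL`, by lowering every
live gate to its tied floor and p1 g8's strong-regime theorem `tail_ge_of_le_marg_strong`).

* `Quant.BlockComb.le_crossing_of_class` — **the class corollary in crossing form** for the levelled model (blobs `0, …, M−1`, blob `k` at the
  `k+1`-st of `M` chain gates `qc`, chain weight `W k = ∏_{i<k+1} qc i`, sizes `sz`, gates `p`): if `x ≤ W k · p k` for every live `k` and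
  `2j < (Σ_{k<M} sz k)·x`, then `x ≤ Σ_{k<M} W k · p k · (CB[sz,p,k] j − CB[sz,p,k](j − sz k))` — the right-hand side of `Quant.blockComb_count_eq`
  (terminal block listed last with gate `1`).  This is the form consumed by the typer's canonical-to-`FarTreeRow` transport
  (`Quant.farTree_blockComb_heavy_ge_of_crossing`, `…QuantFarTreeBlockCombCanonical.lean`): no `TAIL` expression has to be re-elaborated on the tree side.
[this work]
-/

namespace Summit.CriticalPhenomena.PercolationContinuityZ3.Theorems

namespace Quant

namespace BlockComb

open Finset

variable {κ : Type*} [Fintype κ] [DecidableEq κ]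

/-- product-Bernoulli weight of the set `S` of open blob gates -/
local notation3 "wt[" g ", " S "]" => ∏ k, (if k ∈ (S : Finset κ) then (g : κ → ℝ) k else 1 - (g : κ → ℝ) k)

/-- probability that the chain `q` of length `D` is open exactly to depth `i` -/
local notation3 "pd[" D ", " q ", " i "]" =>
  (∏ i' ∈ Finset.range (i : ℕ), (q : ℕ → ℝ) i') * (if (i : ℕ) < (D : ℕ) then 1 - (q : ℕ → ℝ) i else 1)

/-- mass counted at depth `i` in blob configuration `S` -/
local notation3 "mass[" lv ", " a ", " i ", " S "]" =>
  ∑ k ∈ (S : Finset κ).filter (fun k => (lv : κ → ℕ) k ≤ (i : ℕ)), ((a : κ → ℕ) k : ℕ)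

/-- the tail `P(N ≥ j+1)` of the block-comb count, as an explicit finite sum -/
local notation3 "TAIL[" D ", " q ", " lv ", " a ", " g ", " j "]" =>
  ∑ i ∈ Finset.range ((D : ℕ) + 1), pd[D, q, i] *
    ∑ S : Finset κ, wt[g, S] * (if (j : ℕ) + 1 ≤ mass[lv, a, i, S] then (1 : ℝ) else 0)

/-- `CB[a, p, m] t` = probability that the open mass of the first `m` blobs (sizes `a`, gates `p`) is `≤ t` (the recursion of
`…QuantBlobWalk.lean`, verbatim). -/
local notation3 "CB[" a ", " p ", " m "]" =>
  (Nat.rec (motive := fun _ => ℤ → ℝ) (fun t => if (0 : ℤ) ≤ t then (1 : ℝ) else 0)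
    (fun n f t => (p : ℕ → ℝ) n * f (t - ((a : ℕ → ℕ) n : ℤ)) + (1 - (p : ℕ → ℝ) n) * f t) (m : ℕ))

/-- **The class corollary in crossing form** (`Quant.BlockComb.tail_ge_of_class` ∘ `tail_eq_crossing`).  Blobs `0, …, M−1` with sizes `sz k`, private
gates `p k ∈ [0,1]`, blob `k` hanging at the `k+1`-st of `M` chain gates `qc i ∈ [0,1]` (chain weight `W k = ∏_{i<k+1} qc i`): if `x ≤ W k · p k` for
every live `k` (`sz k > 0`), some blob is live and `2j < (Σ_{k<M} sz k)·x`, then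
`x ≤ Σ_{k<M} W k · p k · (CB[sz,p,k] j − CB[sz,p,k](j − sz k))`. [this work] -/
theorem le_crossing_of_class (M : ℕ) (sz : ℕ → ℕ) (p : ℕ → ℝ) (hp : ∀ k, 0 ≤ p k ∧ p k ≤ 1) (qc : ℕ → ℝ)
    (hqc : ∀ i, 0 ≤ qc i ∧ qc i ≤ 1) (j : ℕ) (x : ℝ)
    (hx : ∀ k, k < M → 0 < sz k → x ≤ (∏ i ∈ Finset.range (k + 1), qc i) * p k)
    (hclass : (2 * j : ℝ) < ((∑ k' ∈ Finset.range M, sz k' : ℕ) : ℝ) * x) (hne : ∃ k, k < M ∧ 0 < sz k) :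
    x ≤ ∑ k ∈ Finset.range M, (∏ i ∈ Finset.range (k + 1), qc i) * p k *
        (CB[sz, p, k] (j : ℤ) - CB[sz, p, k] ((j : ℤ) - (sz k : ℤ))) := by
  have hsum : (∑ k' : Fin M, ((sz k'.val : ℕ) : ℝ)) = ((∑ k' ∈ Finset.range M, sz k' : ℕ) : ℝ) := by
    push_cast
    exact Fin.sum_univ_eq_sum_range (fun i => (sz i : ℝ)) M
  have h := tail_ge_of_class (κ := Fin M) M qc hqc (fun k => k.val + 1) (fun k => sz k.val) (fun k => p k.val)
    (fun k => hp k.val) j (fun k _ => k.2) x (fun k hk => hx k.val k.2 hk) (by rw [hsum]; exact hclass)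
    (by obtain ⟨k, hkM, hk⟩ := hne; exact ⟨⟨k, hkM⟩, hk⟩)
  rw [tail_eq_crossing (κ := Fin M) (fun k => k.val) Fin.val_injective M (fun i hi => ⟨⟨i, hi⟩, rfl⟩) (fun k => k.2)
    sz p (fun k => sz k.val) (fun _ => rfl) (fun k => p k.val) (fun _ => rfl) qc j] at h
  exact h

end BlockComb

end Quant

end Summit.CriticalPhenomena.PercolationContinuityZ3.Theorems
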